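import Mathlib
import Literature.NumberTheory.LFunctions.WeilMarkovQuadratic
import Summits.RiemannHypothesis.RiemannHypothesis.Theorems.WeilWindowFlowWindowLipschitzStubFormDomainPos
import Summits.RiemannHypothesis.RiemannHypothesis.Theorems.WeilGroundStateGroundStateSimpleEvenCellThird
import HarnessLib

/-!
# Crux `GroundStateSimpleEven` (stmt-RiemannHypothesis-1526), line `parity-multiplicity-commutator`
# (v3): stub `stub_parabolaRayleigh` (PAR2) — the Rayleigh quotient of the parabolic bump

Support file (`--supports stmt-RiemannHypothesis-1526`) proving the registered sub-goal
`stub_parabolaRayleigh` of the v3 skeleton: for a window `0 < b ≤ (log 2)/2` and the parabolic bump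
`h_b(x) = (1 − x²/b²)⁺` (Lipschitz, in the form domain of the window `[-b, b]`), GIVEN
`‖h_b‖₂² = 16b/15`, `D_t(h_b) = 32b/15` for `t ≥ 2b`, integrability of `ρ D_t(h_b)` on `(0, ∞)`,
the bulk bound `∫_{(0,2b]} ρ D_t(h_b) ≤ b (248/225 + 28b/45)` and integrability of `ρ` on `(2b, ∞)`
(all proved by sibling stubs), the form-domain Rayleigh bound
`(M_b + ε(b)) ‖h_b‖₂² ≤ P(h_b) + 𝓔_b(h_b)` (`…WeilWindowFlowWindowLipschitz.stub_formDomainPos`)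
gives

  `ε(b) ≤ 120/b⁵ (2b cosh(b/2) − 4 sinh(b/2))² + (15/16)(248/225 + 28b/45)
            + 2 ∫_{(2b,∞)} ρ − M_{(log 2)/2}`.

Ingredients: no prime power enters a window `b ≤ (log 2)/2` (`Λ(n) = 0` on `weilPrimeIndex b`, so
`M_b = M_{(log 2)/2}` and the prime part of `𝓔_b` vanishes); the split of `∫_{(0,∞)} ρ D` at `2b`;
the exact pole integral `∫ h_b(x) cosh(x/2) dx = (8/b²)(2b cosh(b/2) − 4 sinh(b/2))` (explicit
primitive); `−2|∫ h_b sinh(x/2)|² ≤ 0`. Template: `weilGroundEnergy_third_le` (…CellThird.lean).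

Mathlib + proved tree files only; no definitions, no named facts, no `sorry`.
-/

noncomputable section

open Set MeasureTheory Filter Complex
open scoped Real Topology ComplexConjugate

namespace Summit.RiemannHypothesis.RiemannHypothesis.Theorems.GroundStateSimpleEven

open Literature.NumberTheory.LFunctions
open Summit.RiemannHypothesis.RiemannHypothesis.Theorems.WeilGroundState

/-! ## No prime enters a window `b ≤ (log 2)/2` -/

set_option linter.dupNamespace false in
/-- No prime power enters a window `b ≤ (log 2)/2`: `Λ(n) = 0` for `n ∈ weilPrimeIndex b`
(`log n < 2b ≤ log 2` forces `n ≤ 1`). [folklore] -/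
theorem par_vonMangoldt_eq_zero_of_mem_weilPrimeIndex {b : ℝ} (hb : b ≤ Real.log 2 / 2) {n : ℕ}
    (hn : n ∈ weilPrimeIndex b) : (ArithmeticFunction.vonMangoldt n : ℝ) = 0 := by
  refine vonMangoldt_eq_zero_of_mem_weilPrimeIndex_log_two_half ?_
  rw [mem_weilPrimeIndex] at hn ⊢
  linarith

set_option linter.dupNamespace false in
/-- The killing constant does not see a window below the first prime:
`M_b = M_{(log 2)/2}` for `b ≤ (log 2)/2`. [folklore] -/
theorem par_weilMarkovConstant_eq {b : ℝ} (hb : b ≤ Real.log 2 / 2) :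
    weilMarkovConstant b = weilMarkovConstant (Real.log 2 / 2) := by
  unfold weilMarkovConstant
  rw [Finset.sum_eq_zero fun n hn ↦ by
      rw [par_vonMangoldt_eq_zero_of_mem_weilPrimeIndex hb hn]; simp,
    Finset.sum_eq_zero fun n hn ↦ by
      rw [vonMangoldt_eq_zero_of_mem_weilPrimeIndex_log_two_half hn]; simp]

set_option linter.dupNamespace false in
/-- Below the first prime the Dirichlet energy is purely archimedean:
`𝓔_b(g) = ∫_{(0,∞)} ρ D_t(g)` for `b ≤ (log 2)/2`. [folklore] -/
theorem par_weilDirichletEnergy_eq {b : ℝ} (hb : b ≤ Real.log 2 / 2) (g : ℝ → ℂ) :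
    weilDirichletEnergy b g = ∫ t in Ioi (0 : ℝ), weilArchDensity t * weilIncrement g t := by
  unfold weilDirichletEnergy
  rw [Finset.sum_eq_zero fun n hn ↦ by
      rw [par_vonMangoldt_eq_zero_of_mem_weilPrimeIndex hb hn]; simp, zero_add]

/-! ## The parabolic bump `h_b = (1 − x²/b²)⁺` -/

set_option linter.dupNamespace false in
/-- If `(1 − (x/b)²)⁺ ≠ 0` and `b > 0` then `-b < x < b`. [folklore] -/
theorem par_mem_Ioo_of_ne_zero {b x : ℝ} (hb : 0 < b) (hx : max (1 - (x / b) ^ 2) 0 ≠ 0) :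
    x ∈ Ioo (-b) b := by
  have h1 : (x / b) ^ 2 < 1 := by
    by_contra h
    exact hx (max_eq_right (by linarith [not_lt.1 h]))
  rw [div_pow, div_lt_one (pow_pos hb 2)] at h1
  exact abs_lt.1 (abs_lt_of_sq_lt_sq h1 hb.le)

set_option linter.dupNamespace false in
/-- The bump `h_b = (1 − x²/b²)⁺` vanishes off the window `[-b, b]`. [folklore] -/
theorem par_eq_zero_of_not_mem {b : ℝ} (hb : 0 < b) {x : ℝ} (hx : x ∉ Icc (-b) b) :
    (((max (1 - (x / b) ^ 2) 0 : ℝ)) : ℂ) = 0 := by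
  by_contra h
  have hne : max (1 - (x / b) ^ 2) 0 ≠ 0 := fun h0 ↦ h (by rw [h0, Complex.ofReal_zero])
  exact hx (Ioo_subset_Icc_self (par_mem_Ioo_of_ne_zero hb hne))

set_option linter.dupNamespace false in
/-- The bump `h_b` is in `L²` (continuous with compact support). [folklore] -/
theorem par_memLp {b : ℝ} (hb : 0 < b) :
    MemLp (fun x : ℝ ↦ (((max (1 - (x / b) ^ 2) 0 : ℝ)) : ℂ)) 2 volume := by
  refine Continuous.memLp_of_hasCompactSupport (by fun_prop) ?_
  exact HasCompactSupport.intro isCompact_Icc fun x hx ↦ par_eq_zero_of_not_mem hb hx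

/-! ## The exact pole integral `∫ h_b(x) cosh(x/2) dx = (8/b²)(2b cosh(b/2) − 4 sinh(b/2))` -/

set_option linter.dupNamespace false in
/-- A primitive of `(1 − x²/b²) cosh(x/2)`:
`2(1 − x²/b²) sinh(x/2) + (8x/b²) cosh(x/2) − (16/b²) sinh(x/2)`. [folklore] -/
theorem par_hasDerivAt_primitive (b x : ℝ) :
    HasDerivAt (fun x : ℝ ↦ 2 * (1 - (x / b) ^ 2) * Real.sinh (x / 2) +
        8 * x / b ^ 2 * Real.cosh (x / 2) - 16 / b ^ 2 * Real.sinh (x / 2))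
      ((1 - (x / b) ^ 2) * Real.cosh (x / 2)) x := by
  have h1 : HasDerivAt (fun x : ℝ ↦ x / 2) (1 / 2) x := (hasDerivAt_id x).div_const 2
  have hs : HasDerivAt (fun x : ℝ ↦ Real.sinh (x / 2)) (Real.cosh (x / 2) * (1 / 2)) x := h1.sinh
  have hc : HasDerivAt (fun x : ℝ ↦ Real.cosh (x / 2)) (Real.sinh (x / 2) * (1 / 2)) x := h1.cosh
  have hx2 : HasDerivAt (fun x : ℝ ↦ x * x) (1 * x + x * 1) x :=
    (hasDerivAt_id x).mul (hasDerivAt_id x)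
  have := ((((hx2.const_mul (2 / b ^ 2)).const_sub 2).mul hs).add
    (((hasDerivAt_id x).const_mul (8 / b ^ 2)).mul hc)).sub (hs.const_mul (16 / b ^ 2))
  refine (this.congr_deriv ?_).congr_of_eventuallyEq (Eventually.of_forall fun y ↦ ?_)
  · simp only [id]; ring
  · simp only [Pi.add_apply, Pi.mul_apply, Pi.sub_apply, id]; ring

set_option linter.dupNamespace false in
/-- `∫_{-b}^{b} (1 − x²/b²) cosh(x/2) dx = (8/b²)(2b cosh(b/2) − 4 sinh(b/2))`. [folklore] -/
theorem par_intervalIntegral_cosh {b : ℝ} (hb : 0 < b) :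
    ∫ x in (-b)..b, (1 - (x / b) ^ 2) * Real.cosh (x / 2) =
      8 / b ^ 2 * (2 * b * Real.cosh (b / 2) - 4 * Real.sinh (b / 2)) := by
  rw [intervalIntegral.integral_eq_sub_of_hasDerivAt (fun x _ ↦ par_hasDerivAt_primitive b x)
    (Continuous.intervalIntegrable (by fun_prop) _ _)]
  have hb' : b ≠ 0 := hb.ne'
  simp only [neg_div, Real.sinh_neg, Real.cosh_neg, div_self hb']
  field_simp
  ring

set_option linter.dupNamespace false in
/-- **The pole integral of the bump**:
`∫ (1 − x²/b²)⁺ cosh(x/2) dx = (8/b²)(2b cosh(b/2) − 4 sinh(b/2))`. [folklore] -/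
theorem par_integral_bump_cosh {b : ℝ} (hb : 0 < b) :
    ∫ x, max (1 - (x / b) ^ 2) 0 * Real.cosh (x / 2) =
      8 / b ^ 2 * (2 * b * Real.cosh (b / 2) - 4 * Real.sinh (b / 2)) := by
  have h1 : ∫ x, max (1 - (x / b) ^ 2) 0 * Real.cosh (x / 2) =
      ∫ x in (-b)..b, max (1 - (x / b) ^ 2) 0 * Real.cosh (x / 2) := by
    symm
    apply intervalIntegral.integral_eq_integral_of_support_subset
    intro x hx
    rw [Function.mem_support] at hx
    have hne : max (1 - (x / b) ^ 2) 0 ≠ 0 := fun h ↦ hx (by rw [h, zero_mul])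
    have := par_mem_Ioo_of_ne_zero hb hne
    exact ⟨this.1, this.2.le⟩
  rw [h1, ← par_intervalIntegral_cosh hb]
  refine intervalIntegral.integral_congr fun x hx ↦ ?_
  rw [Set.uIcc_of_le (by linarith)] at hx
  have hx' : (x / b) ^ 2 ≤ 1 := by
    rw [div_pow, div_le_one (pow_pos hb 2)]
    exact sq_le_sq' (by linarith [hx.1]) hx.2
  simp only [max_eq_left (sub_nonneg.2 hx')]

set_option linter.dupNamespace false in
/-- **The pole form of the bump**: `P(h_b) ≤ 2 ((8/b²)(2b cosh(b/2) − 4 sinh(b/2)))²`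
(drop `−2|∫ h_b sinh(x/2)|² ≤ 0`). [folklore] -/
theorem par_weilPoleForm_le {b : ℝ} (hb : 0 < b) :
    weilPoleForm (fun x : ℝ ↦ (((max (1 - (x / b) ^ 2) 0 : ℝ)) : ℂ)) ≤
      2 * (8 / b ^ 2 * (2 * b * Real.cosh (b / 2) - 4 * Real.sinh (b / 2))) ^ 2 := by
  unfold weilPoleForm
  have hc : ∫ t, (fun x : ℝ ↦ (((max (1 - (x / b) ^ 2) 0 : ℝ)) : ℂ)) t * (Real.cosh (t / 2) : ℂ) =
      ((∫ x, max (1 - (x / b) ^ 2) 0 * Real.cosh (x / 2) : ℝ) : ℂ) := by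
    rw [← integral_complex_ofReal]
    congr 1 with t
    push_cast
    ring
  rw [hc, Complex.norm_real, par_integral_bump_cosh hb, Real.norm_eq_abs, sq_abs]
  linarith [sq_nonneg ‖∫ t, (fun x : ℝ ↦ (((max (1 - (x / b) ^ 2) 0 : ℝ)) : ℂ)) t *
    (Real.sinh (t / 2) : ℂ)‖]

/-! ## The archimedean energy of the bump, split at `2b` -/

set_option linter.dupNamespace false in
/-- Split `∫_{(0,∞)} ρ D_t(g) = ∫_{(0,2b]} ρ D_t(g) + ∫_{(2b,∞)} ρ D_t(g)` and use `D_t(g) = c` on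
`t ≥ 2b`: `∫_{(0,∞)} ρ D(g) ≤ B + c ∫_{(2b,∞)} ρ` whenever `∫_{(0,2b]} ρ D(g) ≤ B`. [folklore] -/
theorem par_archEnergy_le {b c B : ℝ} (hb : 0 < b) {g : ℝ → ℂ}
    (hD : ∀ t : ℝ, 2 * b ≤ t → weilIncrement g t = c)
    (hint : IntegrableOn (fun t : ℝ ↦ weilArchDensity t * weilIncrement g t) (Ioi 0))
    (hbulk : ∫ t in Ioc 0 (2 * b), weilArchDensity t * weilIncrement g t ≤ B) :
    ∫ t in Ioi 0, weilArchDensity t * weilIncrement g t ≤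
      B + c * ∫ t in Ioi (2 * b), weilArchDensity t := by
  have hunion : Ioc (0 : ℝ) (2 * b) ∪ Ioi (2 * b) = Ioi 0 := Ioc_union_Ioi_eq_Ioi (by linarith)
  have hi1 : IntegrableOn (fun t ↦ weilArchDensity t * weilIncrement g t) (Ioc 0 (2 * b)) :=
    hint.mono_set Ioc_subset_Ioi_self
  have hi2 : IntegrableOn (fun t ↦ weilArchDensity t * weilIncrement g t) (Ioi (2 * b)) :=
    hint.mono_set (Ioi_subset_Ioi (by linarith))
  have heq : EqOn (fun t ↦ weilArchDensity t * weilIncrement g t)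
      (fun t ↦ c * weilArchDensity t) (Ioi (2 * b)) := by
    intro t ht
    simp only
    rw [hD t (le_of_lt ht)]
    ring
  rw [← hunion, setIntegral_union Ioc_disjoint_Ioi_same measurableSet_Ioi hi1 hi2,
    setIntegral_congr_fun measurableSet_Ioi heq, integral_const_mul]
  linarith

end Summit.RiemannHypothesis.RiemannHypothesis.Theorems.GroundStateSimpleEven

namespace Summit.RiemannHypothesis.RiemannHypothesis.Theorems

open Literature.NumberTheory.LFunctions

set_option linter.dupNamespace false in
/-- **Registered sub-goal (PAR2) of line `parity-multiplicity-commutator` (v3): the Rayleigh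
quotient of the parabolic bump.** For `0 < b ≤ (log 2)/2` and `h_b = (1 − x²/b²)⁺`, given
`‖h_b‖₂² = 16b/15`, `D_t(h_b) = 32b/15` (`t ≥ 2b`), integrability of `ρ D_t(h_b)` on `(0,∞)`, the
bulk bound `∫_{(0,2b]} ρ D_t(h_b) ≤ b(248/225 + 28b/45)` and integrability of `ρ` on `(2b,∞)`:
`ε(b) ≤ 120/b⁵ (2b cosh(b/2) − 4 sinh(b/2))² + (15/16)(248/225 + 28b/45) + 2∫_{(2b,∞)} ρ`
`− M_{(log 2)/2}` (form-domain Rayleigh bound `stub_formDomainPos`, no prime below `(log 2)/2`,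
exact pole integral, energy split at `2b`). [folklore] -/
theorem stub_parabolaRayleigh :
    ∀ b : ℝ, 0 < b → b ≤ Real.log 2 / 2 →
      (∫ x : ℝ, ‖(((max (1 - (x / b) ^ 2) 0 : ℝ)) : ℂ)‖ ^ 2 = 16 * b / 15) →
      (∀ t : ℝ, 2 * b ≤ t →
        weilIncrement (fun x : ℝ ↦ (((max (1 - (x / b) ^ 2) 0 : ℝ)) : ℂ)) t = 32 * b / 15) →
      IntegrableOn (fun t : ℝ ↦ weilArchDensity t *
        weilIncrement (fun x : ℝ ↦ (((max (1 - (x / b) ^ 2) 0 : ℝ)) : ℂ)) t) (Ioi 0) →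
      (∫ t in Ioc 0 (2 * b), weilArchDensity t *
          weilIncrement (fun x : ℝ ↦ (((max (1 - (x / b) ^ 2) 0 : ℝ)) : ℂ)) t ≤
        b * (248 / 225 + 28 / 45 * b)) →
      IntegrableOn weilArchDensity (Ioi (2 * b)) →
      weilGroundEnergy b ≤
        120 / b ^ 5 * (2 * b * Real.cosh (b / 2) - 4 * Real.sinh (b / 2)) ^ 2 +
          15 / 16 * (248 / 225 + 28 / 45 * b) +
          2 * (∫ t in Ioi (2 * b), weilArchDensity t) - weilMarkovConstant (Real.log 2 / 2) := by
  intro b hb hbl hN hD hint hbulk _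
  have key := WeilWindowFlowWindowLipschitz.stub_formDomainPos b hb
    (fun x : ℝ ↦ (((max (1 - (x / b) ^ 2) 0 : ℝ)) : ℂ)) (GroundStateSimpleEven.par_memLp hb)
    (Eventually.of_forall fun x hx ↦ GroundStateSimpleEven.par_eq_zero_of_not_mem hb hx) hint
  rw [hN, GroundStateSimpleEven.par_weilMarkovConstant_eq hbl,
    GroundStateSimpleEven.par_weilDirichletEnergy_eq hbl] at key
  have hE := GroundStateSimpleEven.par_archEnergy_le hb hD hint hbulk
  have hP := GroundStateSimpleEven.par_weilPoleForm_le hb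
  have k2 := key.trans (add_le_add hP hE)
  rw [← le_div_iff₀ (by positivity)] at k2
  have hb' : b ≠ 0 := hb.ne'
  have k3 : (2 * (8 / b ^ 2 * (2 * b * Real.cosh (b / 2) - 4 * Real.sinh (b / 2))) ^ 2 +
      (b * (248 / 225 + 28 / 45 * b) + 32 * b / 15 * ∫ t in Ioi (2 * b), weilArchDensity t)) /
        (16 * b / 15) =
      120 / b ^ 5 * (2 * b * Real.cosh (b / 2) - 4 * Real.sinh (b / 2)) ^ 2 +
        15 / 16 * (248 / 225 + 28 / 45 * b) + 2 * (∫ t in Ioi (2 * b), weilArchDensity t) := by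
    field_simp
    ring
  rw [k3] at k2
  linarith

end Summit.RiemannHypothesis.RiemannHypothesis.Theorems

end
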